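import Summits.Ventures.GridStability.Bench.WSCC9Deg4ARecertDDeg4RslicesRT2S01PpData2
import Literature.Computation.Certificates.PosSemidefIntList
import HarnessLib
-- PORT cert/sos-5/emit_lean.py@aec66be82ed62442 / source cert/A/lowerk-slices/restart/WSCC9-deg4-A-recertD-deg4-rslices-RT2-s01-pp.json sha256: 223b1deed7abc607ae6d22caf66e3a73f91256de3cd49e45a2e3aebedd0cf179
-- estimated kernel time of this file's `decide`s: 18 s (emitter calibration 2026-08-26; RULING 8 budget 200 s per file)

/-!
# Ventures/GridStability — Bench/WSCC9Deg4ARecertDDeg4RslicesRT2S01PpPsd1.lean: ℤ-LIST PSD ROW BLOCKS 1 of 1 of certificate file `WSCC9-deg4-A-recertD-deg4-rslices-RT2-s01-pp` (system WSCC9, V degree 4, toolchain A)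

Kernel row checks `PSD.rowCheckZ` (Literature/Computation/Certificates/PosSemidefIntList.lean; lever
L5 data refinement + L2 integer data) of the integer rounded Gram certificates `(…_zA, …_zd, …_zBT)`
of certificate `WSCC9-deg4-A-recertD-deg4-rslices-RT2-s01-pp` (data in
`Summits.Ventures.GridStability.Bench.WSCC9Deg4ARecertDDeg4RslicesRT2S01PpData2`): theorems
`deg4_A_recertD_deg4_rslices_RT2_s01_pp_level_incl_free_zr0`,
`deg4_A_recertD_deg4_rslices_RT2_s01_pp_level_incl_free_zr1` — each `∀ i : Fin s, b·c ≤ i < b·(c+1)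
→ rowCheckZ … i = true` by ONE `decide +kernel`. They are assembled into `PSD.IsGramCertZ` /
`GramSOS.QuadNonneg` facts in the proof files `WSCC9Deg4ARecertDDeg4RslicesRT2S01PpPart<k>.lean` /
`WSCC9Deg4ARecertDDeg4RslicesRT2S01Pp.lean`. Split by the emitter so that each file's kernel time
stays inside the RULING 8 budget (estimated 18 s here). CERTIFIED column raw checks; no inequality
is concluded in this file. «algebraic inequalities certified; ROA inclusion pending Lyapunov/
lemma».
-/

namespace Summit.Ventures.GridStability.Bench.WSCC9

open Literature.Computation.Certificates Literature.Computation.Certificates.SOS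
open Literature.Computation.Certificates.SOS.Poly

/-! ### ℤ-list PSD row blocks (`PSD.rowCheckZ`, `decide +kernel`) — data in `Summits.Ventures.GridStability.Bench.WSCC9Deg4ARecertDDeg4RslicesRT2S01PpData` -/

set_option maxHeartbeats 0 in
/-- ℤ-LIST PSD ROW BLOCK 1/2 of `deg4_A_recertD_deg4_rslices_RT2_s01_pp_level_incl_free` (rows 0–19 of 34): the integer residual `A − Bᵀ·diag zd·B` is diagonally dominant on these rows (`PSD.rowCheckZ`, one `decide`). [folklore] -/
theorem deg4_A_recertD_deg4_rslices_RT2_s01_pp_level_incl_free_zr0 : ∀ i : Fin 34, 20 * 0 ≤ i.val → i.val < 20 * (0 + 1) →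
    PSD.rowCheckZ 34 34 deg4_A_recertD_deg4_rslices_RT2_s01_pp_level_incl_free_zA deg4_A_recertD_deg4_rslices_RT2_s01_pp_level_incl_free_zd deg4_A_recertD_deg4_rslices_RT2_s01_pp_level_incl_free_zBT i.val = true := by
  decide +kernel

set_option maxHeartbeats 0 in
/-- ℤ-LIST PSD ROW BLOCK 2/2 of `deg4_A_recertD_deg4_rslices_RT2_s01_pp_level_incl_free` (rows 20–33 of 34): the integer residual `A − Bᵀ·diag zd·B` is diagonally dominant on these rows (`PSD.rowCheckZ`, one `decide`). [folklore] -/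
theorem deg4_A_recertD_deg4_rslices_RT2_s01_pp_level_incl_free_zr1 : ∀ i : Fin 34, 20 * 1 ≤ i.val → i.val < 20 * (1 + 1) →
    PSD.rowCheckZ 34 34 deg4_A_recertD_deg4_rslices_RT2_s01_pp_level_incl_free_zA deg4_A_recertD_deg4_rslices_RT2_s01_pp_level_incl_free_zd deg4_A_recertD_deg4_rslices_RT2_s01_pp_level_incl_free_zBT i.val = true := by
  decide +kernel

end Summit.Ventures.GridStability.Bench.WSCC9
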